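import Literature.IUT.HodgeTheaters.PuncturedEllipticCoveringsCor12OfFreePro
import HarnessLib

/-!
# [IUTchI] Cor. 1.2: the [AbsTopII] Cor. 3.3 (ii) step with PRINT-FAITHFUL torsion-freeness («no element of
# finite order») in place of Mathlib's `IsMulTorsionFree` («unique roots») — proof-only repair of the closer chain

Mochizuki, *Inter-universal Teichmüller theory I*, kurims manuscript (May 2020), §1, Corollary 1.2, proof p. 39
l. 24–27: "the algorithms of [AbsTopII], Corollary 3.3, (i), (ii) … allow one to reconstruct `Π_C` … as well as
the subgroups `Δ_X ⊆ Δ_C ⊆ Π_C`" [cite: Mochizuki2012, IUTchI Cor 1.2 p.39] (D-0012 claim key; series status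
DISPUTED — nothing of the series is asserted here); S. Mochizuki, *Topics in Absolute Anabelian Geometry II*,
J. Math. Sci. Univ. Tokyo **20** (2013), Cor. 3.3 (ii) p. 68: "the collection of open subgroups `J ⊆ Π_C` of
index `2` such that `J ∩ Δ_C` is torsion-free [i.e., the covering determined by `J` is a scheme — cf.
[AbsTopI], Lemma 4.1, (iv)]" [cite: MochizukiAbsTopII2013, Cor 3.3 (ii) p.68].

PROOF-ONLY file (cell abc-iut, seat abc-iut-L5-t1 gen 11; FINDING T1g11-F1 + HUB census
`plan/L5/SUBDAG-IUTchI-Cor12.md` §R).  WHY.  The Cor. 1.2 closer chain of abc-iut-L5-d4 (p437972 → p441649 →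
p442282 → p443323 → p447384 → p448270; this seat's p491635) displays the [AbsTopII] Cor. 3.3 (ii) side
conditions as `htf : IsMulTorsionFree ↥(Π_X ⊓ Δ_C)` and `huniq′ : ∀ J ∈ semiEllipticDoubleCoverSubgroups Π'_C,
J ⊓ Δ'_C = Δ'_X`.  Mathlib's `IsMulTorsionFree` is «`x ↦ xⁿ` injective for `n ≠ 0`» (UNIQUE ROOTS), which
agrees with «no nontrivial element of finite order» only for commutative groups
(`isMulTorsionFree_iff_not_isOfFinOrder` is stated under `[CommGroup]`); the free profinite group `F̂₂ ≅ Δ_X` of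
a once-punctured elliptic curve is torsion-free but does NOT have unique square roots (it contains the projective
group `ℤ_p ⋊ ℤ₂`, in which `(ac)² = a²`), so at the genuine datum `htf` is unsatisfiable and `huniq′` vacuous.
This file re-runs the ONE step of the chain that consumes them — abc-iut-L5-d4's `map_deltaX_eq_of_semiElliptic`
inside `core_extension_of_geomIsMaxTFGNormalIn` (p441649) — on the print-faithful forms
* `htf⁰ : ∀ g : ↥(Π_X ⊓ Δ_C), IsOfFinOrder g → g = 1` ("`Δ_X` is torsion-free"), which p491635
  `PuncturedEllipticData.torsionFree_deltaX_of_isFreeProOn` DISCHARGES from «`Δ_X` free profinite on two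
  generators» (census object (A)); and
* `huniq⁰ : ∀ J : Subgroup Π'_C, IsOpen J → J.index = 2 → (∀ g : ↥(J ⊓ Δ'_C), IsOfFinOrder g → g = 1) →
  J ⊓ Δ'_C = Π'_X ⊓ Δ'_C` ([AbsTopII] Cor. 3.3 (ii) + Rmk. 3.1.1 at the primed datum: the semi-elliptic double
  cover is unique, print's torsion-freeness),
and re-assembles everything above that step BY NAME (abc-iut-L5-d4's `map_deltaC_eq_of_geomIsMaxTFGNormalIn`,
`map_eq_of_extends`, `ArrowCoveringClaims.map_piXbar_eq_of_map_deltaX`, `cusps_correspond_of_recoversCusps`,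
`map_piCbar_eq_of_cusps`, `exists_continuous_restrict_piCbar`, `image_map_subtype_transport`,
`image_cuspClassX_eq` / `image_cuspClassC_eq`, `ofCarrow_viaX`, `characteristicNatureOfCoverings_of_core_extensions`,
`geomIsMaxTFGNormalIn_of_geomTFG`, `ModLCuspLaws.exists_commutator_not_mem_H`,
`CuspGalois.not_deltaXbar_le_H_of_relIndex`; abc-iut-L5-t1's `arrowCoveringClaims_pe_of_modLCuspLaws`):
* `isOfFinOrder_torsionFree_map_inf_geom` — print's torsion-freeness of `J ∩ Δ` is carried along a bicontinuous
  `Θ : Π_C ⥲ Π'_C` with `Θ(Δ_C) = Δ'_C` (the `IsOfFinOrder` twin of abc-iut-L4's `isMulTorsionFree_map_inf_geom`);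
* `map_deltaX_eq_of_torsionFree` — `Θ(Δ_X) = Δ'_X` from `htf⁰`, `huniq⁰`;
* `core_extension_of_geomIsMaxTFGNormalIn_faithful`, `ofXarrow_of_geomIsMaxTFG_of_recoversCusps_faithful`,
  `characteristicNatureOfCoverings_of_recoversCusps_viaX_faithful` — the p441649 / p442282 / p447384 theorems
  with (`htf`, `huniq′`) ↦ (`htf⁰`, `huniq⁰`), proofs verbatim over the d4 lemmas;
* `InitialThetaData.pe_characteristicNatureOfCoverings_viaX_of_freePro_faithful` — **the Cor. 1.2 closer at the
  genuine `K`-level data with `htf` GONE (discharged from `hfree`) and `huniq′ ↦ huniq⁰`**; displayed binders: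
  DATA `C C′ A` · FACT-instance-shaped `hfree hfree′` · LAW `hL L′ h0 h0′ huniq⁰ hext hextC hA hA′ hIH′`
  (12 → … the v6 census's 14 LAW are now 10, two of which are the F-0206 instances `hA hA′`).

HONEST FRAMING: classical group theory over the tree's interfaces; binders are assumption labels; typed ≠
discharged for the anabelian inputs ([AbsTopII] Cor. 3.3 (i)(ii), [AbsTopI] Lem. 4.5 (v)); no L4 or d4
declaration is edited or restated (abc-iut-L4's `semiEllipticDoubleCoverSubgroups` keeps its meaning; its
print-faithful successor is the L4-lead's call, FINDING T1g11-F1); nothing here bears on [IUTchIII] Cor. 3.12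
or asserts that abc is proved or refuted.  No `def`, no instance, no new `Prop` fact; axioms standard.
-/

noncomputable section

namespace Literature.IUT.HodgeTheaters

namespace PuncturedEllipticData

open scoped Pointwise
open Literature.AnabelianGeometry.AbsoluteAnabelian
open Literature.AnabelianGeometry.AbsoluteAnabelian.FundamentalExtension (CuspidalAlgorithm)

universe u

variable {D D' : PuncturedEllipticData.{u}}

/-! ### §1. `Θ(Δ_X) = Δ'_X` from print-faithful torsion-freeness -/

/-- **Print's torsion-freeness of `J ∩ Δ` is carried along `Θ` with `Θ(Δ_C) = Δ'_C`**: if `J ∩ Δ_C` has no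
nontrivial element of finite order, neither has `Θ(J) ∩ Δ'_C` (the map `y ↦ Θ⁻¹ y` is an injective
homomorphism `Θ(J) ∩ Δ'_C → J ∩ Δ_C`; the `IsOfFinOrder` twin of abc-iut-L4's `isMulTorsionFree_map_inf_geom`).
[cite: MochizukiAbsTopII2013, Cor 3.3 (ii) p.68] -/
theorem isOfFinOrder_torsionFree_map_inf_geom (Θ : D.PiC ≃ₜ* D'.PiC)
    (hΘΔ : D.DeltaC.map Θ.toMulEquiv.toMonoidHom = D'.DeltaC) {J : Subgroup D.PiC}
    (hJ : ∀ g : ↥(J ⊓ D.DeltaC), IsOfFinOrder g → g = 1) :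
    ∀ g : ↥(J.map Θ.toMulEquiv.toMonoidHom ⊓ D'.DeltaC), IsOfFinOrder g → g = 1 := by
  have hmem : ∀ y : ↥(J.map Θ.toMulEquiv.toMonoidHom ⊓ D'.DeltaC), Θ.symm y ∈ J ⊓ D.DeltaC := fun y =>
    (AbsTopII.mem_map_inf_geom_iff (E := D.E) (F := D'.E) Θ hΘΔ J y).mp y.2
  let f : ↥(J.map Θ.toMulEquiv.toMonoidHom ⊓ D'.DeltaC) →* ↥(J ⊓ D.DeltaC) :=
    { toFun := fun y => ⟨Θ.symm y, hmem y⟩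
      map_one' := Subtype.ext (map_one Θ.symm)
      map_mul' := fun a b => Subtype.ext (map_mul Θ.symm (a : D'.PiC) (b : D'.PiC)) }
  have hf : Function.Injective f := by
    intro a b h
    have h' : Θ.symm (a : D'.PiC) = Θ.symm (b : D'.PiC) := congrArg Subtype.val h
    exact Subtype.ext (Θ.symm.injective h')
  intro g hg
  have h1 : f g = 1 := hJ (f g) (f.isOfFinOrder hg)
  exact hf (by rw [h1, map_one])

/-- **"[AbsTopII], Corollary 3.3, (ii) … allow[s] one to reconstruct … `Δ_X ⊆ Δ_C`"** (Cor. 1.2 proof p. 39) with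
PRINT-FAITHFUL torsion-freeness: an isomorphism of topological groups `Θ : Π_C ⥲ Π'_C` with `Θ(Δ_C) = Δ'_C`
carries `Δ_X` onto `Δ'_X`, GIVEN (`htf`) that `Δ_X = Π_X ∩ Δ_C` has no nontrivial element of finite order
(`X` a scheme, [AbsTopI] Lem. 4.1 (iv)) and (`huniq`) that every open index-`2` subgroup `J ⊆ Π'_C` whose
geometric part has no nontrivial element of finite order satisfies `J ∩ Δ'_C = Δ'_X` ([AbsTopII] Cor. 3.3 (ii) +
Rmk. 3.1.1: the unique double covering of `C` by a hyperbolic CURVE).  Repairs abc-iut-L5-d4's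
`map_deltaX_eq_of_semiElliptic` (p437972), whose `IsMulTorsionFree` binder is unsatisfiable when `Δ_X ≅ F̂₂`.
([IUTchI] Cor 1.2 p.39) [claim: Mochizuki2012, status: disputed] -/
theorem map_deltaX_eq_of_torsionFree (Θ : D.PiC ≃ₜ* D'.PiC)
    (hΘΔ : D.DeltaC.map Θ.toMulEquiv.toMonoidHom = D'.DeltaC)
    (htf : ∀ g : ↥(D.PiX ⊓ D.DeltaC), IsOfFinOrder g → g = 1)
    (huniq : ∀ J : Subgroup D'.PiC, IsOpen (J : Set D'.PiC) → J.index = 2 →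
      (∀ g : ↥(J ⊓ D'.DeltaC), IsOfFinOrder g → g = 1) → J ⊓ D'.DeltaC = D'.PiX ⊓ D'.DeltaC) :
    (D.PiX ⊓ D.DeltaC).map Θ.toMulEquiv.toMonoidHom = D'.PiX ⊓ D'.DeltaC := by
  rw [Subgroup.map_inf _ _ _ Θ.injective, hΘΔ]
  refine huniq _ ?_ ?_ (isOfFinOrder_torsionFree_map_inf_geom Θ hΘΔ htf)
  · rw [Subgroup.coe_map]
    exact Θ.toHomeomorph.isOpenMap _ D.isOpen_piX
  · rw [← D.index_piX]
    exact Subgroup.index_map_of_bijective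
      (show Function.Bijective Θ.toMulEquiv.toMonoidHom from Θ.bijective) D.PiX

/-! ### §2. The d4 chain above that step, re-run with (`htf⁰`, `huniq⁰`) -/

/-- abc-iut-L5-d4's `core_extension_of_geomIsMaxTFGNormalIn` (p441649) with PRINT-FAITHFUL torsion-freeness:
the pair-level anabelian binder (`hext` = [AbsTopII] Cor. 3.3 (i) extension form; `GeomIsMaxTFGNormalIn ⊤` =
[AbsAnab] Lem. 1.1.4 (i)'s conclusion at the two cores) yields extensions `Θ` with `Θ(Δ_X) = Δ'_X`,
`Θ(Δ_C) = Δ'_C`. ([IUTchI] Cor 1.2 p.39) [claim: Mochizuki2012, status: disputed] -/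
theorem core_extension_of_geomIsMaxTFGNormalIn_faithful {A : Subgroup D.PiC} {A' : Subgroup D'.PiC}
    (h : D.E.GeomIsMaxTFGNormalIn ⊤) (h' : D'.E.GeomIsMaxTFGNormalIn ⊤)
    (htf : ∀ g : ↥(D.PiX ⊓ D.DeltaC), IsOfFinOrder g → g = 1)
    (huniq : ∀ J : Subgroup D'.PiC, IsOpen (J : Set D'.PiC) → J.index = 2 →
      (∀ g : ↥(J ⊓ D'.DeltaC), IsOfFinOrder g → g = 1) → J ⊓ D'.DeltaC = D'.PiX ⊓ D'.DeltaC)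
    (hext : ∀ φ : A ≃* A', Continuous φ → Continuous φ.symm →
      ∃ Θ : D.PiC ≃ₜ* D'.PiC, ∀ x : A, Θ (x : D.PiC) = (φ x : D'.PiC)) :
    ∀ φ : A ≃* A', Continuous φ → Continuous φ.symm →
      ∃ Θ : D.PiC ≃* D'.PiC, Continuous Θ ∧ Continuous Θ.symm ∧
        (∀ x : A, Θ (x : D.PiC) = (φ x : D'.PiC)) ∧
        (D.PiX ⊓ D.DeltaC).map Θ.toMonoidHom = D'.PiX ⊓ D'.DeltaC ∧
        D.DeltaC.map Θ.toMonoidHom = D'.DeltaC := by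
  intro φ hφ hφ'
  obtain ⟨Θ, hΘ⟩ := hext φ hφ hφ'
  have hΔ := map_deltaC_eq_of_geomIsMaxTFGNormalIn h h' Θ
  exact ⟨Θ.toMulEquiv, Θ.continuous, Θ.symm.continuous, hΘ,
    map_deltaX_eq_of_torsionFree Θ hΔ htf huniq, hΔ⟩

/-- abc-iut-L5-d4's `ofXarrow_of_geomIsMaxTFG_of_recoversCusps` (p442282) with PRINT-FAITHFUL torsion-freeness:
the non-resp'd clause of Cor. 1.2 (`Π_{X̲→} ⥲ Π'_{X̲→}` extends to `Π_C̲ ⥲ Π'_C̲` carrying the two cusp classes),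
proof VERBATIM over the d4 lemmas. ([IUTchI] Cor 1.2 p.39) [claim: Mochizuki2012, status: disputed] -/
theorem ofXarrow_of_geomIsMaxTFG_of_recoversCusps_faithful (h : D.ArrowCoveringClaims)
    (h' : D'.ArrowCoveringClaims) (C : D.CuspGalois) (C' : D'.CuspGalois)
    (hX : D.PiXbar.relIndex D.PiX = D.l) (hX' : D'.PiXbar.relIndex D'.PiX = D'.l)
    (h0 : ¬ D.inertia D.ε0 ≤ D.piXarrow) (h0' : ¬ D'.inertia D'.ε0 ≤ D'.piXarrow)
    (h114 : D.E.GeomIsMaxTFGNormalIn ⊤) (h114' : D'.E.GeomIsMaxTFGNormalIn ⊤)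
    (htf : ∀ g : ↥(D.PiX ⊓ D.DeltaC), IsOfFinOrder g → g = 1)
    (huniq : ∀ J : Subgroup D'.PiC, IsOpen (J : Set D'.PiC) → J.index = 2 →
      (∀ g : ↥(J ⊓ D'.DeltaC), IsOfFinOrder g → g = 1) → J ⊓ D'.DeltaC = D'.PiX ⊓ D'.DeltaC)
    (hext : ∀ φ : D.piXarrow ≃* D'.piXarrow, Continuous φ → Continuous φ.symm →
      ∃ Θ : D.PiC ≃ₜ* D'.PiC, ∀ x : D.piXarrow, Θ (x : D.PiC) = (φ x : D'.PiC))
    (A : CuspidalAlgorithm.{u}) (hA : A.RecoversCusps D.extXbar C.cuspidalDataXbar)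
    (hA' : A.RecoversCusps D'.extXbar C'.cuspidalDataXbar) :
    ∀ φ : D.piXarrow ≃* D'.piXarrow, Continuous φ → Continuous φ.symm →
      ∃ Φ : D.PiCbar ≃* D'.PiCbar, Continuous Φ ∧
        (∀ (x : D.PiC) (hx : x ∈ D.piXarrow) (hx' : x ∈ D.PiCbar),
          (Φ ⟨x, hx'⟩ : D'.PiC) = (φ ⟨x, hx⟩ : D'.PiC)) ∧
        Subgroup.map Φ.toMonoidHom '' D.cuspClassX = D'.cuspClassX ∧
        Subgroup.map Φ.toMonoidHom '' D.cuspClassC = D'.cuspClassC := by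
  intro φ hφ hφ'
  obtain ⟨Θ, hc, hc', hΘext, hΘX, hΘΔ⟩ :=
    core_extension_of_geomIsMaxTFGNormalIn_faithful h114 h114' htf huniq hext φ hφ hφ'
  have hΘ : D.piXarrow.map Θ.toMonoidHom = D'.piXarrow := map_eq_of_extends φ Θ hΘext
  have hΘXbar : D.PiXbar.map Θ.toMonoidHom = D'.PiXbar :=
    h.map_piXbar_eq_of_map_deltaX h' C C' hX hX' Θ hc hc' hΘ hΘX hΘΔ
  obtain ⟨hcusp, hcusp'⟩ := cusps_correspond_of_recoversCusps C C' A hA hA' Θ hc hc' hΘXbar hΘΔ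
  have hΘCbar : D.PiCbar.map Θ.toMonoidHom = D'.PiCbar :=
    h.map_piCbar_eq_of_cusps h' C C' hX hX' h0 h0' Θ hc hc' hΘ hΘX hΘΔ hcusp'
  obtain ⟨Φ, hΦc, hΦ⟩ := exists_continuous_restrict_piCbar Θ hc hΘCbar
  refine ⟨Φ, hΦc, fun x hx hx' => ?_,
    image_map_subtype_transport Θ Φ hΦ _ _
      (image_cuspClassX_eq h h' C C' Θ hΘ hΘΔ hΘXbar hΘCbar h0 h0' hcusp hcusp'),
    image_map_subtype_transport Θ Φ hΦ _ _
      (image_cuspClassC_eq h h' C C' Θ hΘ hΘΔ hΘXbar hΘCbar h0 h0' hcusp)⟩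
  rw [hΦ ⟨x, hx'⟩]
  exact hΘext ⟨x, hx⟩

/-- abc-iut-L5-d4's `characteristicNatureOfCoverings_of_recoversCusps_viaX` (p447384) with PRINT-FAITHFUL
torsion-freeness: Corollary 1.2 (both clauses) from the printed anabelian inputs BY NAME, the via-`X̲` route
(no `hLem45C`), the `ι`-law `hι'`. ([IUTchI] Cor 1.2 p.39) [claim: Mochizuki2012, status: disputed] -/
theorem characteristicNatureOfCoverings_of_recoversCusps_viaX_faithful (h : D.ArrowCoveringClaims)
    (h' : D'.ArrowCoveringClaims) (C : D.CuspGalois) (C' : D'.CuspGalois)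
    (hX : D.PiXbar.relIndex D.PiX = D.l) (hX' : D'.PiXbar.relIndex D'.PiX = D'.l)
    (h0 : ¬ D.inertia D.ε0 ≤ D.piXarrow) (h0' : ¬ D'.inertia D'.ε0 ≤ D'.piXarrow)
    (h114 : D.E.GeomIsMaxTFGNormalIn ⊤) (h114' : D'.E.GeomIsMaxTFGNormalIn ⊤)
    (htf : ∀ g : ↥(D.PiX ⊓ D.DeltaC), IsOfFinOrder g → g = 1)
    (huniq : ∀ J : Subgroup D'.PiC, IsOpen (J : Set D'.PiC) → J.index = 2 →
      (∀ g : ↥(J ⊓ D'.DeltaC), IsOfFinOrder g → g = 1) → J ⊓ D'.DeltaC = D'.PiX ⊓ D'.DeltaC)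
    (hext : ∀ φ : D.piXarrow ≃* D'.piXarrow, Continuous φ → Continuous φ.symm →
      ∃ Θ : D.PiC ≃ₜ* D'.PiC, ∀ x : D.piXarrow, Θ (x : D.PiC) = (φ x : D'.PiC))
    (hextC : ∀ ψ : D.piCarrow ≃* D'.piCarrow, Continuous ψ → Continuous ψ.symm →
      ∃ Θ : D.PiC ≃ₜ* D'.PiC, ∀ x : D.piCarrow, Θ (x : D.PiC) = (ψ x : D'.PiC))
    (A : CuspidalAlgorithm.{u}) (hA : A.RecoversCusps D.extXbar C.cuspidalDataXbar)
    (hA' : A.RecoversCusps D'.extXbar C'.cuspidalDataXbar)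
    (hι' : ∀ c ∈ D'.DeltaCbar, c ∉ D'.DeltaXbar → ∃ v ∈ D'.PiX ⊓ D'.DeltaC,
      c * v * c⁻¹ * v⁻¹ ∉ (⁅D'.PiX ⊓ D'.DeltaC, D'.PiX ⊓ D'.DeltaC⁆ ⊔ Subgroup.closure
        ((fun y : D'.PiC => y ^ D'.l) '' (D'.PiX ⊓ D'.DeltaC : Set D'.PiC))).topologicalClosure) :
    D.CharacteristicNatureOfCoverings D' :=
  characteristicNatureOfCoverings_of_core_extensions h h'
    (ofXarrow_of_geomIsMaxTFG_of_recoversCusps_faithful h h' C C' hX hX' h0 h0' h114 h114' htf huniq hext A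
      hA hA')
    (ofCarrow_viaX h h' C C' hX hX' h0 h0'
      (core_extension_of_geomIsMaxTFGNormalIn_faithful h114 h114' htf huniq hextC)
      (fun Θ hc hc' hΘXbar hΘΔ =>
        (cusps_correspond_of_recoversCusps C C' A hA hA' Θ hc hc' hΘXbar hΘΔ).1) hι')

end PuncturedEllipticData

/-! ### §3. The closer at the genuine `K`-level data: `htf` GONE, `huniq′ ↦ huniq⁰` -/

namespace InitialThetaData

open scoped Pointwise
open Literature.AnabelianGeometry.AbsoluteAnabelian
open Literature.AnabelianGeometry.AbsoluteAnabelian.FundamentalExtension (CuspidalAlgorithm)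

universe u u'

variable {F : Type u} {K : Type} {Fbar : Type} [Field F] [NumberField F] [Field K] [NumberField K]
  [Algebra F K] [Field Fbar] [Algebra F Fbar] [Algebra K Fbar]
  {E : WeierstrassCurve F} [E.IsElliptic] {l : ℕ} {Pb : BadPlacePredicates K}
  (D : InitialThetaData F K Fbar E l Pb)
  {F' : Type u'} {K' : Type} [Field F'] [NumberField F'] [Field K'] [NumberField K'] [Algebra F' K']
  {Fbar' : Type} [Field Fbar'] [Algebra F' Fbar'] [Algebra K' Fbar']
  {E' : WeierstrassCurve F'} [E'.IsElliptic] {l' : ℕ} {Pb' : BadPlacePredicates K'}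
  (D' : InitialThetaData F' K' Fbar' E' l' Pb')

/-- **[IUTchI] Cor. 1.2 between the `K`-level data of two initial Θ-data — closer of record with the vacuous
`IsMulTorsionFree` binder REMOVED**: p491635's `pe_characteristicNatureOfCoverings_viaX_of_freePro` re-run on
PRINT-FAITHFUL torsion-freeness; "`Δ_X` torsion-free" is DISCHARGED from `hfree` (`Δ_X` free profinite on two
generators, [SGA1 XIII 2.12] / [AbsTopI] Lem. 4.5 (i) vocabulary) by
`PuncturedEllipticData.torsionFree_deltaX_of_isFreeProOn`; the uniqueness of the semi-elliptic double cover at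
the primed datum is displayed as `huniq` in print's form.  Remaining displayed binders: DATA `C C′ A`;
instance-shaped `hfree hfree′`; LAW `hL L′` (abc-iut-L5-t1's `ModLCuspLaws`), `h0 h0′` (GAP G-L5d4g6-1),
`huniq`, `hext hextC` ([AbsTopII] Cor. 3.3 (i) extension form), `hA hA′` (F-0206 instances), `hIH′`.
([IUTchI] Cor 1.2 p.39) [claim: Mochizuki2012, status: disputed] -/
theorem pe_characteristicNatureOfCoverings_viaX_of_freePro_faithful
    (C : D.geom.pe.CuspGalois) (C' : D'.geom.pe.CuspGalois)
    (hL : D.geom.pe.ModLCuspLaws) (L' : D'.geom.pe.ModLCuspLaws)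
    {gens : Fin 2 → ↥(D.geom.pe.PiX ⊓ D.geom.pe.DeltaC)}
    (hfree : IsFreeProOn ↥(D.geom.pe.PiX ⊓ D.geom.pe.DeltaC) Set.univ gens)
    {gens' : Fin 2 → ↥(D'.geom.pe.PiX ⊓ D'.geom.pe.DeltaC)}
    (hfree' : IsFreeProOn ↥(D'.geom.pe.PiX ⊓ D'.geom.pe.DeltaC) Set.univ gens')
    (h0 : ¬ D.geom.pe.inertia D.geom.pe.ε0 ≤ D.geom.pe.piXarrow)
    (h0' : ¬ D'.geom.pe.inertia D'.geom.pe.ε0 ≤ D'.geom.pe.piXarrow)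
    (huniq : ∀ J : Subgroup D'.geom.pe.PiC, IsOpen (J : Set D'.geom.pe.PiC) → J.index = 2 →
      (∀ g : ↥(J ⊓ D'.geom.pe.DeltaC), IsOfFinOrder g → g = 1) →
        J ⊓ D'.geom.pe.DeltaC = D'.geom.pe.PiX ⊓ D'.geom.pe.DeltaC)
    (hext : ∀ φ : D.geom.pe.piXarrow ≃* D'.geom.pe.piXarrow, Continuous φ → Continuous φ.symm →
      ∃ Θ : D.geom.pe.PiC ≃ₜ* D'.geom.pe.PiC,
        ∀ x : D.geom.pe.piXarrow, Θ (x : D.geom.pe.PiC) = (φ x : D'.geom.pe.PiC))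
    (hextC : ∀ ψ : D.geom.pe.piCarrow ≃* D'.geom.pe.piCarrow, Continuous ψ → Continuous ψ.symm →
      ∃ Θ : D.geom.pe.PiC ≃ₜ* D'.geom.pe.PiC,
        ∀ x : D.geom.pe.piCarrow, Θ (x : D.geom.pe.PiC) = (ψ x : D'.geom.pe.PiC))
    (A : CuspidalAlgorithm.{0}) (hA : A.RecoversCusps D.geom.pe.extXbar C.cuspidalDataXbar)
    (hA' : A.RecoversCusps D'.geom.pe.extXbar C'.cuspidalDataXbar)
    (hIH' : ∀ x : D'.geom.pe.Cusp, D'.geom.pe.inertia x ≤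
      (⁅D'.geom.pe.PiX ⊓ D'.geom.pe.DeltaC, D'.geom.pe.PiX ⊓ D'.geom.pe.DeltaC⁆ ⊔
        Subgroup.closure ((fun y : D'.geom.pe.PiC => y ^ D'.geom.pe.l) ''
          (D'.geom.pe.PiX ⊓ D'.geom.pe.DeltaC : Set D'.geom.pe.PiC))).topologicalClosure) :
    D.geom.pe.CharacteristicNatureOfCoverings D'.geom.pe :=
  PuncturedEllipticData.characteristicNatureOfCoverings_of_recoversCusps_viaX_faithful
    (D.arrowCoveringClaims_pe_of_modLCuspLaws C hL) (D'.arrowCoveringClaims_pe_of_modLCuspLaws C' L') C C'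
    D.pe_relIndex_piXbar_piX D'.pe_relIndex_piXbar_piX h0 h0'
    (PuncturedEllipticData.geomIsMaxTFGNormalIn_of_geomTFG D.peNFBase
      (D.geom.pe.geomTFG_of_isFreeProOn hfree))
    (PuncturedEllipticData.geomIsMaxTFGNormalIn_of_geomTFG D'.peNFBase
      (D'.geom.pe.geomTFG_of_isFreeProOn hfree'))
    (D.geom.pe.torsionFree_deltaX_of_isFreeProOn hfree) huniq hext hextC A hA hA'
    (L'.exists_commutator_not_mem_H hIH'
      (C'.not_deltaXbar_le_H_of_relIndex D'.pe_relIndex_piXbar_piX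
        (D'.geom.pe.relIndex_H_eq_sq_of_isFreeProOn hfree')))

end InitialThetaData

end Literature.IUT.HodgeTheaters
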